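import Mathlib
import HarnessLib
import Summits.ResolutionOfSingularities.ResolutionOfSingularities.Theorems.WildQuotientsWildQuotientResolutionS1aPrincipalAway
import Summits.ResolutionOfSingularities.ResolutionOfSingularities.Theorems.WildQuotientsWildQuotientResolutionS1aNodeChartAway
import Summits.ResolutionOfSingularities.ResolutionOfSingularities.Theorems.WildQuotientsWildQuotientResolutionS1aPrincipalCentre

/-!
# S1a — PRINCIPAL-CENTRE CHARTS SHRINK TO INVARIANT BASIC OPENS THROUGH THE SUPPORT (`PrincipalCentreChartShrink`, support form)

[OURS · L1 W4.5c · lead-1 g8; plan-1 SIG `L/w45c/W45cKillOrAux.lean` v3 `PrincipalCentreChartShrink` — CORRECTED: the statement of the sheet is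
false at points off `supp(𝒦.ideal d)` (there, after localising, `(f)` becomes the unit ideal and Mathlib's `RingTheory.Sequence.IsRegular`
fails); the form below, at points OF THE SUPPORT, is what `KillableAt`-transport needs] — NOT statements of the manuscript; counted 0; AI-level
work, weaker than expert review. Crux stmt-ResolutionOfSingularities-17941, line `s1a-logminvertex` v6. Route-independent.

* `map_comap_traceFiltration_eq` — the filtration clause localises: `(K_n ∩ Γ(O)) · Γ(D(b)) = e_{D(b)}⁻¹ (K_n(B[h⁻¹]) ∩ (B[h⁻¹])₀)`;
* `map_span_ne_top_of_mem_support` — a point of `supp(𝒦.ideal d) ∩ D(b)` forces `(f) · B[h⁻¹] ≠ ⊤` (`h = e b`);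
* **`isCentreChart_basicOpen`**, **`isPrincipalCentreChart_basicOpen`** — for a (principal-)centre chart `O` of `(𝒦, d)` and a
  `G`-invariant `b ∈ Γ(V, O)` with `D(b) ∩ supp(𝒦.ideal d) ≠ ∅`, the invariant basic open `D(b)` is again a (principal-)centre chart of
  `(𝒦, d)` — node `(B[h⁻¹], locPiece, sigmaAway)`, centre `f/1`, same weights and Veronese degree, kill clause by `PrincipalAway.kill_away`;
* **`exists_isPrincipalCentreChart_le`** — `PrincipalCentreChartShrink` (support form): a principal-centre chart has principal-centre
  sub-charts through every point of the support, inside any `G`-stable open (`G` finite); `exists_isCentreChart_le` likewise.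
-/

set_option linter.dupNamespace false

noncomputable section

open CategoryTheory AlgebraicGeometry TopologicalSpace
open Literature.AlgebraicGeometry.Resolution Literature.AlgebraicGeometry.RelativeSpec
open Summit.ResolutionOfSingularities.ResolutionOfSingularities.Theorems.WildQuotientResolution.S1
open Summit.ResolutionOfSingularities.ResolutionOfSingularities.Theorems.WildQuotientResolution.S1.NodeAtlas
open Summit.ResolutionOfSingularities.ResolutionOfSingularities.Theorems.WildQuotientResolution.S1.GradedLocalization
open Summit.ResolutionOfSingularities.ResolutionOfSingularities.Theorems.WildQuotientResolution.S1.ProducerStep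
open Summit.ResolutionOfSingularities.ResolutionOfSingularities.Theorems.WildQuotientResolution.S1.GoodCharts
open Summit.ResolutionOfSingularities.ResolutionOfSingularities.Theorems.WildQuotientResolution.S1.NodeAway
open Summit.ResolutionOfSingularities.ResolutionOfSingularities.Theorems.WildQuotientResolution.S1.NodeChartAway
open Summit.ResolutionOfSingularities.ResolutionOfSingularities.Theorems.WildQuotientResolution.S1.CoarseChart
open Summit.ResolutionOfSingularities.ResolutionOfSingularities.Theorems.WildQuotientResolution.S1.CentreAway
open Summit.ResolutionOfSingularities.ResolutionOfSingularities.Theorems.WildQuotientResolution.S1.PrincipalAway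

namespace Summit.ResolutionOfSingularities.ResolutionOfSingularities.Theorems.WildQuotientResolution.S1.PrincipalChartShrink

universe u v

section Generic

variable {ι : Type v} [AddCommGroup ι] [DecidableEq ι] {B : Type u} [CommRing B] (𝒜 : ι → AddSubgroup B) [GradedRing 𝒜]
  {h : B} (hh : h ∈ 𝒜 0)

/-- **Extension/contraction square for an extended ideal of `(B[h⁻¹])₀`** (pure algebra): for ring isos `e : A ≃ 𝒜 0`, `e' : A' ≃ (B[h⁻¹])₀` and a ring hom
`alg : A → A'` with `e' ∘ alg = zeroToAwayZero ∘ e`, one has `alg(e⁻¹ I) · A' = e'⁻¹ (I · (B[h⁻¹])₀)` for every ideal `I` of `𝒜 0`. [OURS · L1 W4.5c] -/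
theorem map_comap_eq_comap_map {A A' : Type*} [CommRing A] [CommRing A'] (alg : A →+* A') (e : A ≃+* ↥(𝒜 0))
    (e' : letI := locGradedRing 𝒜 hh; A' ≃+* ↥(locPiece 𝒜 hh 0))
    (hcompat : letI := locGradedRing 𝒜 hh; ∀ t : A, e' (alg t) = zeroToAwayZero 𝒜 hh (e t)) (I : Ideal ↥(𝒜 0)) :
    letI := locGradedRing 𝒜 hh
    (I.comap (e : A →+* ↥(𝒜 0))).map alg = (I.map (zeroToAwayZero 𝒜 hh)).comap (e' : A' →+* ↥(locPiece 𝒜 hh 0)) := by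
  letI := locGradedRing 𝒜 hh
  apply le_antisymm
  · rw [Ideal.map_le_iff_le_comap]
    intro x hx
    rw [Ideal.mem_comap] at hx
    rw [Ideal.mem_comap, Ideal.mem_comap, RingHom.coe_coe, hcompat]
    exact Ideal.mem_map_of_mem _ hx
  · intro y hy
    rw [Ideal.mem_comap, RingHom.coe_coe] at hy
    obtain ⟨k, z, hz, hyz⟩ := exists_of_mem_map_zeroToAwayZero 𝒜 hh hy
    have h1 : e' (alg (e.symm z)) = zeroToAwayZero 𝒜 hh z := by rw [hcompat, e.apply_symm_apply]
    have h2 : y = alg (e.symm z) * e'.symm (invSelfZero 𝒜 hh) ^ k := by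
      apply e'.injective
      rw [hyz, map_mul, map_pow, h1, RingEquiv.apply_symm_apply]
    rw [h2]
    refine Ideal.mul_mem_right _ _ (Ideal.mem_map_of_mem _ ?_)
    rw [Ideal.mem_comap, RingHom.coe_coe, e.apply_symm_apply]
    exact hz

end Generic

section Chart2

variable {V Y : Scheme.{u}} {q : V ⟶ Y} {G : Type u} [Group G] (ρ : ActionOver q G) (O : ρ.StableAffineOpens)
  (hOaff : IsAffineOpen O.1) {b : Γ(V, O.1)} (hb : ∀ g : G, actO ρ O g b = b)
  {ι : Type v} [AddCommGroup ι] [DecidableEq ι] {B : Type u} [CommRing B] (𝒜 : ι → AddSubgroup B) [GradedRing 𝒜]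
  (e : Γ(V, O.1) ≃+* ↥(𝒜 0)) {c : ℕ} (f : Fin c → B) (w : Fin c → ℕ)

/-- The square `e_{D(b)} ∘ (restriction) = zeroToAwayZero ∘ e` on `Γ(V, O)`. -/
theorem basicOpenNodeEquiv_algebraMap (t : Γ(V, O.1)) :
    letI := locGradedRing 𝒜 (e b).2
    basicOpenNodeEquiv ρ O hOaff b 𝒜 e (algebraMap Γ(V, O.1) Γ(V, V.basicOpen b) t) = zeroToAwayZero 𝒜 (e b).2 (e t) := by
  letI := locGradedRing 𝒜 (e b).2
  apply Subtype.ext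
  rw [coe_basicOpenNodeEquiv_map, coe_zeroToAwayZero]

/-- **The filtration clause localises**: extension to `Γ(V, D(b))` of `e⁻¹(K_n ∩ 𝒜 0)` is `e_{D(b)}⁻¹(K_n(B[h⁻¹]) ∩ (B[h⁻¹])₀)`. [OURS · L1 W4.5c] -/
theorem map_comap_traceFiltration_eq (n : ℕ) :
    letI := locGradedRing 𝒜 (e b).2
    (((traceFiltration 𝒜 f w).ideal n).comap (e : Γ(V, O.1) →+* ↥(𝒜 0))).map (algebraMap Γ(V, O.1) Γ(V, V.basicOpen b)) =
      ((traceFiltration (locPiece 𝒜 (e b).2) (algebraMap B (Localization.Away ((e b : ↥(𝒜 0)) : B)) ∘ f) w).ideal n).comap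
        (basicOpenNodeEquiv ρ O hOaff b 𝒜 e : Γ(V, V.basicOpen b) →+* ↥(locPiece 𝒜 (e b).2 0)) := by
  letI := locGradedRing 𝒜 (e b).2
  rw [traceFiltration_away]
  exact map_comap_eq_comap_map 𝒜 (e b).2 (algebraMap Γ(V, O.1) Γ(V, V.basicOpen b)) e (basicOpenNodeEquiv ρ O hOaff b 𝒜 e)
    (basicOpenNodeEquiv_algebraMap ρ O hOaff 𝒜 e) _

/-- **The filtration clause of the shrunk chart**, in the exact shape of the `IsCentreChart`/`IsPrincipalCentreChart` field. [OURS · L1 W4.5c] -/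
theorem filtration_basicOpen_eq (𝒦 : ReesFiltration V)
    (h𝒦 : ∀ n : ℕ, (𝒦.filtration ⟨O.1, hOaff⟩).ideal n = ((traceFiltration 𝒜 f w).ideal n).comap (e : Γ(V, O.1) →+* ↥(𝒜 0))) (n : ℕ) :
    letI := locGradedRing 𝒜 (e b).2
    (𝒦.filtration ⟨V.basicOpen b, hOaff.basicOpen b⟩).ideal n =
      ((traceFiltration (locPiece 𝒜 (e b).2) (algebraMap B (Localization.Away ((e b : ↥(𝒜 0)) : B)) ∘ f) w).ideal n).comap
        (basicOpenNodeEquiv ρ O hOaff b 𝒜 e : Γ(V, V.basicOpen b) →+* ↥(locPiece 𝒜 (e b).2 0)) := by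
  letI := locGradedRing 𝒜 (e b).2
  rw [ReesFiltration.filtration_ideal, ← map_comap_traceFiltration_eq ρ O hOaff 𝒜 e f w n, ← h𝒦 n, ReesFiltration.filtration_ideal]
  exact ((𝒦.ideal n).map_ideal_basicOpen ⟨O.1, hOaff⟩ b).symm

/-- **A point of `supp(𝒦.ideal d) ∩ D(b)` forces `(f) · B[h⁻¹] ≠ ⊤`** (`h = e b`), when `𝒦` is the trace filtration on `O`. [OURS · L1 W4.5c] -/
theorem map_span_ne_top_of_mem_support (𝒦 : ReesFiltration V) (d : ℕ) (hw : ∀ i, 0 < w i)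
    (h𝒦 : (𝒦.filtration ⟨O.1, hOaff⟩).ideal d = ((traceFiltration 𝒜 f w).ideal d).comap (e : Γ(V, O.1) →+* ↥(𝒜 0)))
    {v : V} (hvO : v ∈ O.1) (hv : v ∈ V.basicOpen b) (hvs : v ∈ (𝒦.ideal d).support) :
    (Ideal.span (Set.range f)).map (algebraMap B (Localization.Away ((e b : ↥(𝒜 0)) : B))) ≠ ⊤ := by
  intro H
  obtain ⟨N, hN⟩ := exists_pow_mem_traceFiltration_of_map_eq_top 𝒜 (e b).2 f w hw d H
  have hbN : b ^ N ∈ (𝒦.ideal d).ideal ⟨O.1, hOaff⟩ := by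
    rw [← ReesFiltration.filtration_ideal, h𝒦, Ideal.mem_comap, RingHom.coe_coe, map_pow]
    exact hN
  have hz := (Scheme.IdealSheafData.mem_support_iff_of_mem (I := 𝒦.ideal d) (U := ⟨O.1, hOaff⟩) hvO).mp hvs
  rw [Scheme.mem_zeroLocus_iff] at hz
  have hvN : v ∉ V.basicOpen (b ^ N) := hz _ hbN
  rcases Nat.eq_zero_or_pos N with h0 | hpos
  · rw [h0, pow_zero, Scheme.basicOpen_one] at hvN
    exact hvN hvO
  · rw [V.basicOpen_pow b hpos] at hvN
    exact hvN hv

end Chart2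

section Shrink

variable {V Y : Scheme.{u}} {q : V ⟶ Y} {G : Type u} [Group G] {ρ : ActionOver q G} {g₀ : G} {p : ℕ}

/-- **CENTRE CHARTS SHRINK** to invariant basic opens meeting the support of the centre. [OURS · L1 W4.5c] -/
theorem isCentreChart_basicOpen {𝒦 : ReesFiltration V} {d : ℕ} {O : ρ.StableAffineOpens} (hO : IsCentreChart p ρ g₀ 𝒦 d O)
    {b : Γ(V, O.1)} (hb : ∀ g : G, actO ρ O g b = b) {v : V} (hvO : v ∈ O.1) (hv : v ∈ V.basicOpen b) (hvs : v ∈ (𝒦.ideal d).support) :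
    IsCentreChart p ρ g₀ 𝒦 d (basicOpenStable ρ O hO.1 hb) := by
  obtain ⟨hOaff, m, r, B, _, 𝒜, _, σ, e, hnode, hσ, c, f, δ, w, hc, hf, hw, hK1, hK1', hσJ, h𝒦, hver⟩ := hO
  obtain ⟨hσb, hnode', hσ', -⟩ := exists_nodeData_basicOpen ρ O hOaff hb 𝒜 e g₀ σ hnode hσ
  letI := locGradedRing 𝒜 (e b).2
  haveI : IsRegularRing (B ⧸ Ideal.span (Set.range f)) := hK1'
  have hne := map_span_ne_top_of_mem_support ρ O hOaff 𝒜 e f w 𝒦 d hw (h𝒦 d) hvO hv hvs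
  refine ⟨isAffineOpen_basicOpenStable ρ O hOaff hb, m, r, Localization.Away ((e b : ↥(𝒜 0)) : B), inferInstance,
    locPiece 𝒜 (e b).2, locGradedRing 𝒜 (e b).2, sigmaAway σ hσb, basicOpenNodeEquiv ρ O hOaff b 𝒜 e, hnode', hσ', c,
    algebraMap B (Localization.Away ((e b : ↥(𝒜 0)) : B)) ∘ f, δ, w, hc, algebraMap_comp_mem_locPiece 𝒜 (e b).2 f hf, hw,
    isRegular_ofFn_map _ (Submonoid.powers ((e b : ↥(𝒜 0)) : B)) f hK1 hne,
    isRegularRing_quotient_span_map _ (Submonoid.powers ((e b : ↥(𝒜 0)) : B)) f,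
    map_sigmaAway_weightedFiltration_le f w σ hσb hσJ, filtration_basicOpen_eq ρ O hOaff 𝒜 e f w 𝒦 h𝒦,
    veroneseNormalised_away 𝒜 (e b).2 f w hver⟩

/-- **PRINCIPAL-CENTRE CHARTS SHRINK** to invariant basic opens meeting the support of the centre: node `(B[h⁻¹], locPiece, sigmaAway)`,
centre `f/1`, same weights and Veronese degree; the kill clause by `PrincipalAway.kill_away`. [OURS · L1 W4.5c] -/
theorem isPrincipalCentreChart_basicOpen {𝒦 : ReesFiltration V} {d : ℕ} {O : ρ.StableAffineOpens}
    (hO : IsPrincipalCentreChart p ρ g₀ 𝒦 d O) {b : Γ(V, O.1)} (hb : ∀ g : G, actO ρ O g b = b)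
    {v : V} (hvO : v ∈ O.1) (hv : v ∈ V.basicOpen b) (hvs : v ∈ (𝒦.ideal d).support) :
    IsPrincipalCentreChart p ρ g₀ 𝒦 d (basicOpenStable ρ O hO.1 hb) := by
  obtain ⟨hOaff, m, r, B, _, 𝒜, _, σ, e, hnode, hσ, c, f, δ, w, hc, hf, hw, hK1, hK1', hσJ, h𝒦, hver, hprin⟩ := hO
  obtain ⟨hσb, hnode', hσ', -⟩ := exists_nodeData_basicOpen ρ O hOaff hb 𝒜 e g₀ σ hnode hσ
  have hσp : ∀ x : B, (⇑σ)^[p] x = x := hnode.2.2.2.2.2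
  letI := locGradedRing 𝒜 (e b).2
  haveI : IsRegularRing (B ⧸ Ideal.span (Set.range f)) := hK1'
  have hne := map_span_ne_top_of_mem_support ρ O hOaff 𝒜 e f w 𝒦 d hw (h𝒦 d) hvO hv hvs
  refine ⟨isAffineOpen_basicOpenStable ρ O hOaff hb, m, r, Localization.Away ((e b : ↥(𝒜 0)) : B), inferInstance,
    locPiece 𝒜 (e b).2, locGradedRing 𝒜 (e b).2, sigmaAway σ hσb, basicOpenNodeEquiv ρ O hOaff b 𝒜 e, hnode', hσ', c,
    algebraMap B (Localization.Away ((e b : ↥(𝒜 0)) : B)) ∘ f, δ, w, hc, algebraMap_comp_mem_locPiece 𝒜 (e b).2 f hf, hw,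
    isRegular_ofFn_map _ (Submonoid.powers ((e b : ↥(𝒜 0)) : B)) f hK1 hne,
    isRegularRing_quotient_span_map _ (Submonoid.powers ((e b : ↥(𝒜 0)) : B)) f,
    map_sigmaAway_weightedFiltration_le f w σ hσb hσJ, filtration_basicOpen_eq ρ O hOaff 𝒜 e f w 𝒦 h𝒦,
    veroneseNormalised_away 𝒜 (e b).2 f w hver, ?_⟩
  -- the KILL clause, localised
  intro hp' hσp' d' β hβ hσβ hd'
  exact kill_away 𝒜 (e b).2 f w σ hσJ hp' hσp hσb (fun d'' b' hb' hσb' hd'' => hprin hp' hσp d'' b' hb' hσb' hd'') hp' hσp' d' β hβ hσβ hd'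

/-- **`PrincipalCentreChartShrink`, SUPPORT FORM**: a principal-centre chart has arbitrarily small principal-centre sub-charts through
every point of the support of the centre, inside any `G`-stable open (`G` finite). [OURS · L1 W4.5c] -/
theorem exists_isPrincipalCentreChart_le [Finite G] {𝒦 : ReesFiltration V} {d : ℕ} {O : ρ.StableAffineOpens}
    (hO : IsPrincipalCentreChart p ρ g₀ 𝒦 d O) {v : V} (hvO : v ∈ O.1) (hvs : v ∈ (𝒦.ideal d).support)
    (U : V.Opens) (hU : ∀ g : G, (ρ.aut g).hom ⁻¹ᵁ U = U) (hvU : v ∈ U) :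
    ∃ O'' : ρ.StableAffineOpens, v ∈ O''.1 ∧ O''.1 ≤ O.1 ∧ O''.1 ≤ U ∧ IsAffineOpen O''.1 ∧ IsPrincipalCentreChart p ρ g₀ 𝒦 d O'' := by
  obtain ⟨b, hb, hvb, hbU⟩ := exists_invariant_basicOpen ρ O hO.1 hvO U hU hvU
  exact ⟨basicOpenStable ρ O hO.1 hb, hvb, V.basicOpen_le b, hbU, isAffineOpen_basicOpenStable ρ O hO.1 hb,
    isPrincipalCentreChart_basicOpen hO hb hvO hvb hvs⟩

/-- Centre charts shrink likewise (support form). [OURS · L1 W4.5c] -/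
theorem exists_isCentreChart_le [Finite G] {𝒦 : ReesFiltration V} {d : ℕ} {O : ρ.StableAffineOpens}
    (hO : IsCentreChart p ρ g₀ 𝒦 d O) {v : V} (hvO : v ∈ O.1) (hvs : v ∈ (𝒦.ideal d).support)
    (U : V.Opens) (hU : ∀ g : G, (ρ.aut g).hom ⁻¹ᵁ U = U) (hvU : v ∈ U) :
    ∃ O'' : ρ.StableAffineOpens, v ∈ O''.1 ∧ O''.1 ≤ O.1 ∧ O''.1 ≤ U ∧ IsAffineOpen O''.1 ∧ IsCentreChart p ρ g₀ 𝒦 d O'' := by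
  obtain ⟨b, hb, hvb, hbU⟩ := exists_invariant_basicOpen ρ O hO.1 hvO U hU hvU
  exact ⟨basicOpenStable ρ O hO.1 hb, hvb, V.basicOpen_le b, hbU, isAffineOpen_basicOpenStable ρ O hO.1 hb,
    isCentreChart_basicOpen hO hb hvO hvb hvs⟩

end Shrink

end Summit.ResolutionOfSingularities.ResolutionOfSingularities.Theorems.WildQuotientResolution.S1.PrincipalChartShrink

end
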